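import Summits.Ventures.Crystal3D.Theorems.StickyWulffConstantCoaxialWallLawEndRowIntReadings
import HarnessLib

/-!
# An integer model of the typed census row, III: rational model points and the reflected frame family

HONEST FRAMING. Venture `Summits/Ventures/Crystal3D` (cell `crystal3d-full`), helper `--supports` the crux `CoaxialWallLaw`
(stmt-Ventures-19481, line `WallLedgerF`).  Continues `…EndRowIntModel` / `…EndRowIntReadings` (seat 19481-p1 gen 12).  Purpose: the
CROSS moves and DEPTH-ONE chain classes of the word automaton (`…EndRowDefs`) involve twinned frames; their slot images and menu
normals are RATIONAL vectors of the `√18`-cubic model.  This file: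

* §7 rational points `iptQ v = v/√18`, `PQ v = Qr (iptQ v)`, `P u = PQ (cast u)`, membership `PQ v ∈ Xof S ↔ v ∈ SQ S`;
* §8 rational normals `nv n = √6 · Qr (iptQ n)` (`n·n = 3`), the physical reflection `Rf n` across `(nv n)^⊥` acts on model points
  by the rational reflection `rq n v = v − (2 (v·n)/3) n` (`Rf_apply_Qr_iptQ`), preserves dot products;
* §9 `RatFrame`: a frame `Φ` with rational slot images `g i` and menu vectors `w c` (`hslot / hmenu / hmenu' / hinner / hw`);
  the BASE frame `L` (`gBase = 3 sᵢ`, `wBase = cubeInt`), and `RatFrame.reflect F c₀` = `Φ.trans (Rf (w c₀))` with tables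
  `gR / wR` — again a `RatFrame` (menu normals transfer by conjugation, `isMenuNormal_trans_iff`).
WHAT THIS IS NOT: no census constant is claimed here; F-C1 not moved.
-/

noncomputable section

namespace Summit.Ventures.Crystal3D.Theorems

open Summit.Ventures.Crystal3D Finset NearIdentity
open Literature.MathematicalPhysics.StatisticalMechanics (barlowPos fccStacking constHagg)
open scoped InnerProductSpace

namespace EndRowFloor

/-! ### §7 Rational model points -/

/-- The point with ambient coordinates `v/√18`, `v` rational. -/
def iptQ (v : Fin 3 → ℚ) : EuclideanSpace ℝ (Fin 3) :=
  (Real.sqrt 18)⁻¹ • (WithLp.toLp 2 fun i => (v i : ℝ))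

/-- Rational dot product. -/
def dq (u v : Fin 3 → ℚ) : ℚ := u 0 * v 0 + u 1 * v 1 + u 2 * v 2

/-- Integer vectors as rational vectors. -/
def castQ (u : Fin 3 → ℤ) : Fin 3 → ℚ := fun i => (u i : ℚ)

/-- Coordinates of `iptQ v`. -/
theorem iptQ_apply (v : Fin 3 → ℚ) (i : Fin 3) : iptQ v i = (Real.sqrt 18)⁻¹ * (v i : ℝ) := by
  simp [iptQ]

/-- `ipt` is `iptQ` of the cast. -/
theorem ipt_eq_iptQ (u : Fin 3 → ℤ) : ipt u = iptQ (castQ u) := by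
  ext i; rw [ipt_apply, iptQ_apply, castQ, Rat.cast_intCast]

/-- `iptQ` is additive. -/
theorem iptQ_add (u v : Fin 3 → ℚ) : iptQ (u + v) = iptQ u + iptQ v := by
  ext i; simp [iptQ_apply, mul_add]

/-- `iptQ` respects subtraction. -/
theorem iptQ_sub (u v : Fin 3 → ℚ) : iptQ (u - v) = iptQ u - iptQ v := by
  ext i; simp [iptQ_apply, mul_sub]

/-- `iptQ` respects rational scaling. -/
theorem iptQ_smul (r : ℚ) (v : Fin 3 → ℚ) : iptQ (r • v) = (r : ℝ) • iptQ v := by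
  ext i; simp [iptQ_apply]; ring

/-- `iptQ` respects negation. -/
theorem iptQ_neg (v : Fin 3 → ℚ) : iptQ (-v) = -iptQ v := by
  ext i; simp [iptQ_apply]

/-- Inner products of rational model points. -/
theorem inner_iptQ (u v : Fin 3 → ℚ) : ⟪iptQ u, iptQ v⟫_ℝ = (dq u v : ℝ) / 18 := by
  have h18 : Real.sqrt 18 * Real.sqrt 18 = 18 := Real.mul_self_sqrt (by norm_num)
  have h0 : (Real.sqrt 18)⁻¹ * (Real.sqrt 18)⁻¹ = 1 / 18 := by
    rw [← mul_inv, h18]; norm_num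
  have hin : ⟪(WithLp.toLp 2 fun i => (u i : ℝ) : EuclideanSpace ℝ (Fin 3)),
      (WithLp.toLp 2 fun i => (v i : ℝ))⟫_ℝ = (dq u v : ℝ) := by
    simp [PiLp.inner_apply, Fin.sum_univ_three, dq]; ring
  rw [iptQ, iptQ, real_inner_smul_left, real_inner_smul_right, hin, ← mul_assoc, h0]
  ring

/-- `iptQ` is injective. -/
theorem iptQ_injective : Function.Injective iptQ := by
  intro u v h
  funext i
  have := congrArg (fun x : EuclideanSpace ℝ (Fin 3) => x i) h
  simp only [iptQ_apply] at this
  have h18 : (Real.sqrt 18)⁻¹ ≠ 0 := inv_ne_zero (ne_of_gt sqrt18_pos)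
  have := mul_left_cancel₀ h18 this
  exact_mod_cast this

/-- The physical point of a rational model vector. -/
def PQ (v : Fin 3 → ℚ) : EuclideanSpace ℝ (Fin 3) := Qr (iptQ v)

/-- `P` is `PQ` of the cast. -/
theorem P_eq_PQ (u : Fin 3 → ℤ) : P u = PQ (castQ u) := by rw [P, PQ, ipt_eq_iptQ]

/-- `PQ` is injective. -/
theorem PQ_injective : Function.Injective PQ := fun _ _ h => iptQ_injective (Qr.injective h)

/-- `PQ` is additive up to the tilt. -/
theorem PQ_add (u v : Fin 3 → ℚ) : PQ (u + v) = PQ u + Qr (iptQ v) := by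
  rw [PQ, iptQ_add, map_add]; rfl

/-- `castQ` is injective. -/
theorem castQ_injective : Function.Injective castQ := by
  intro u v h; funext i; have := congrFun h i; simp only [castQ] at this; exact_mod_cast this

/-- The rational copy of a site set. -/
def SQ (S : Finset (Fin 3 → ℤ)) : Finset (Fin 3 → ℚ) := S.image castQ

/-- Membership of a rational point in the carried configuration. -/
theorem mem_Xof_Q {S : Finset (Fin 3 → ℤ)} {v : Fin 3 → ℚ} : PQ v ∈ Xof S ↔ v ∈ SQ S := by
  rw [SQ, Finset.mem_image, Xof, Finset.mem_map]
  constructor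
  · rintro ⟨u, hu, h⟩
    refine ⟨u, hu, ?_⟩
    rw [Pemb_apply, P_eq_PQ] at h
    exact PQ_injective h
  · rintro ⟨u, hu, rfl⟩
    exact ⟨u, hu, by rw [Pemb_apply, P_eq_PQ]⟩

/-! ### §8 Rational normals and reflections -/

/-- The unit vector attached to a rational `n` with `n·n = 3`: `√6 · Qr (iptQ n)`. -/
def nv (n : Fin 3 → ℚ) : EuclideanSpace ℝ (Fin 3) := Real.sqrt 6 • Qr (iptQ n)

/-- `menuOf k` is `nv` of the cast. -/
theorem menuOf_eq_nv (k : Fin 3 → ℤ) : menuOf k = nv (castQ k) := by rw [menuOf, nv, ipt_eq_iptQ]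

/-- `⟪Qr (iptQ v), nv n⟫ = √6 (v·n)/18`. -/
theorem inner_Qr_iptQ_nv (v n : Fin 3 → ℚ) : ⟪Qr (iptQ v), nv n⟫_ℝ = Real.sqrt 6 * (dq v n : ℝ) / 18 := by
  rw [nv, real_inner_smul_right, Qr.inner_map_map, inner_iptQ]; ring

/-- `nv n` is a unit vector when `n·n = 3`. -/
theorem norm_nv {n : Fin 3 → ℚ} (hn : dq n n = 3) : ‖nv n‖ = 1 := by
  have h6 : (0 : ℝ) ≤ Real.sqrt 6 := Real.sqrt_nonneg _
  have hsq : ‖nv n‖ ^ 2 = 1 := by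
    rw [nv, norm_smul, Qr.norm_map, mul_pow, Real.norm_of_nonneg h6, Real.sq_sqrt (by norm_num),
      ← real_inner_self_eq_norm_sq, inner_iptQ, hn]
    norm_num
  have hnn := norm_nonneg (nv n)
  nlinarith

/-- The rational reflection across `n^⊥` (`n·n = 3`): `v ↦ v − (2 (v·n)/3) n`. -/
def rq (n v : Fin 3 → ℚ) : Fin 3 → ℚ := v - (2 * dq v n / 3) • n

/-- The physical reflection across `(nv n)^⊥`. -/
def Rf (n : Fin 3 → ℚ) : EuclideanSpace ℝ (Fin 3) ≃ₗᵢ[ℝ] EuclideanSpace ℝ (Fin 3) := (ℝ ∙ nv n)ᗮ.reflection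

/-- The physical reflection acts on rational model points by the rational reflection. -/
theorem Rf_apply_Qr_iptQ {n : Fin 3 → ℚ} (hn : dq n n = 3) (v : Fin 3 → ℚ) :
    Rf n (Qr (iptQ v)) = Qr (iptQ (rq n v)) := by
  rw [Rf, reflection_unit_apply (norm_nv hn), inner_Qr_iptQ_nv, rq, iptQ_sub, map_sub, iptQ_smul, map_smul, nv,
    smul_smul]
  congr 2
  have h66 : Real.sqrt 6 * Real.sqrt 6 = 6 := Real.mul_self_sqrt (by norm_num)
  push_cast
  have : (2 : ℝ) * (Real.sqrt 6 * (dq v n : ℝ) / 18) * Real.sqrt 6 = 2 * (dq v n : ℝ) * (Real.sqrt 6 * Real.sqrt 6) / 18 := by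
    ring
  rw [this, h66]; ring

/-- The physical reflection on `nv` vectors. -/
theorem Rf_apply_nv {n : Fin 3 → ℚ} (hn : dq n n = 3) (w : Fin 3 → ℚ) : Rf n (nv w) = nv (rq n w) := by
  rw [nv, map_smul, Rf_apply_Qr_iptQ hn, nv]

/-- Rational reflections preserve dot products (`n·n = 3`). -/
theorem dq_rq {n : Fin 3 → ℚ} (hn : dq n n = 3) (u v : Fin 3 → ℚ) : dq (rq n u) (rq n v) = dq u v := by
  simp only [rq, dq, Pi.sub_apply, Pi.smul_apply, smul_eq_mul] at hn ⊢
  have : (2 * (u 0 * n 0 + u 1 * n 1 + u 2 * n 2) / 3) * (2 * (v 0 * n 0 + v 1 * n 1 + v 2 * n 2) / 3) *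
      (n 0 * n 0 + n 1 * n 1 + n 2 * n 2) =
      (2 * (u 0 * n 0 + u 1 * n 1 + u 2 * n 2) / 3) * (2 * (v 0 * n 0 + v 1 * n 1 + v 2 * n 2) / 3) * 3 := by rw [hn]
  linear_combination this

/-! ### §9 Frames with rational data -/

/-- Slot images of the base frame: `3 sᵢ`. -/
def gBase : Fin 12 → (Fin 3 → ℚ) := fun i => castQ (slot3 i)

/-- Menu vectors of the base frame: the eight sign vectors. -/
def wBase : Fin 8 → (Fin 3 → ℚ) := fun c => castQ (cubeInt c)

/-- Reflecting a slot table across `n`. -/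
def gR (n : Fin 3 → ℚ) (g : Fin 12 → (Fin 3 → ℚ)) : Fin 12 → (Fin 3 → ℚ) := fun i => rq n (g i)

/-- Reflecting a menu table across `n`. -/
def wR (n : Fin 3 → ℚ) (w : Fin 8 → (Fin 3 → ℚ)) : Fin 8 → (Fin 3 → ℚ) := fun c => rq n (w c)

/-- The mirrored slot across the menu vector `w c` for tables `(g, w)`: `g i − 2 (sᵢ·c) (w c)`. -/
def mirQ (g : Fin 12 → (Fin 3 → ℚ)) (w : Fin 8 → (Fin 3 → ℚ)) (i : Fin 12) (c : Fin 8) : Fin 3 → ℚ :=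
  g i - ((2 * dz (slotInt i) (cubeInt c) : ℤ) : ℚ) • w c

/-- Fullness test for the slot table `g`. -/
def fullQ (g : Fin 12 → (Fin 3 → ℚ)) (T : Finset (Fin 3 → ℚ)) (v : Fin 3 → ℚ) : Bool :=
  decide (∀ i : Fin 12, v + g i ∈ T)

/-- Twin-reading failure test for the tables `(g, w)` (some slot witnesses a violated clause). -/
def twinFailQ (g : Fin 12 → (Fin 3 → ℚ)) (w : Fin 8 → (Fin 3 → ℚ)) (T : Finset (Fin 3 → ℚ)) (v : Fin 3 → ℚ)
    (c : Fin 8) : Bool :=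
  decide (∃ i : Fin 12, (dz (slotInt i) (cubeInt c) ≤ 0 ∧ v + g i ∉ T) ∨
    (dz (slotInt i) (cubeInt c) < 0 ∧ v + mirQ g w i c ∉ T) ∨ (0 < dz (slotInt i) (cubeInt c) ∧ v + g i ∈ T))

/-- Twin-reading success test for the tables `(g, w)`. -/
def twinOKQ (g : Fin 12 → (Fin 3 → ℚ)) (w : Fin 8 → (Fin 3 → ℚ)) (T : Finset (Fin 3 → ℚ)) (v : Fin 3 → ℚ)
    (c : Fin 8) : Bool :=
  decide ((∀ i : Fin 12, dz (slotInt i) (cubeInt c) ≤ 0 → v + g i ∈ T) ∧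
    (∀ i : Fin 12, dz (slotInt i) (cubeInt c) < 0 → v + mirQ g w i c ∈ T) ∧
    (∀ i : Fin 12, 0 < dz (slotInt i) (cubeInt c) → v + g i ∉ T))

/-- A frame together with RATIONAL DATA: its slot images `Qr (iptQ (g i))`, its menu normals `nv (w c)`. -/
structure RatFrame where
  /-- the frame -/
  Φ : EuclideanSpace ℝ (Fin 3) ≃ₗᵢ[ℝ] EuclideanSpace ℝ (Fin 3)
  /-- slot images -/
  g : Fin 12 → (Fin 3 → ℚ)
  /-- menu normal vectors -/
  w : Fin 8 → (Fin 3 → ℚ)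
  /-- slot images are rational model points -/
  hslot : ∀ i : Fin 12, Φ (slotSite i) = Qr (iptQ (g i))
  /-- every menu normal is one of the eight -/
  hmenu : ∀ m, IsMenuNormal Φ m → ∃ c : Fin 8, m = nv (w c)
  /-- the eight are menu normals -/
  hmenu' : ∀ c : Fin 8, IsMenuNormal Φ (nv (w c))
  /-- slot/normal products are the integer menu values -/
  hinner : ∀ (i : Fin 12) (c : Fin 8), ⟪Φ (slotSite i), nv (w c)⟫_ℝ = (dz (slotInt i) (cubeInt c) : ℝ) / Real.sqrt 6
  /-- the normal vectors have `n·n = 3` -/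
  hw : ∀ c : Fin 8, dq (w c) (w c) = 3

/-- The BASE frame `L`: slot images `3 sᵢ`, menu normals `cubeInt c`. -/
def RatFrame.base : RatFrame where
  Φ := L
  g := gBase
  w := wBase
  hslot := fun i => by rw [L_slotSite, ipt_eq_iptQ]; rfl
  hmenu := fun m hm => by
    obtain ⟨c, rfl⟩ := exists_menuOf_of_menu hm
    exact ⟨c, menuOf_eq_nv _⟩
  hmenu' := fun c => by
    have := isMenuNormal_menuOf c
    rwa [menuOf_eq_nv] at this
  hinner := fun i c => by
    have := inner_L_slotSite_menuOf i (cubeInt c)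
    rwa [menuOf_eq_nv] at this
  hw := fun c => by
    have : dz (cubeInt c) (cubeInt c) = 3 := by fin_cases c <;> decide
    have h := congrArg (fun z : ℤ => (z : ℚ)) this
    simpa [dq, dz, wBase, castQ] using h

/-- Menu normals transfer through a trailing isometry: `IsMenuNormal (Φ.trans M) m ↔ IsMenuNormal Φ (M.symm m)`. -/
theorem isMenuNormal_trans_iff (Φ M : EuclideanSpace ℝ (Fin 3) ≃ₗᵢ[ℝ] EuclideanSpace ℝ (Fin 3))
    (m : EuclideanSpace ℝ (Fin 3)) : IsMenuNormal (Φ.trans M) m ↔ IsMenuNormal Φ (M.symm m) := by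
  unfold IsMenuNormal
  have key : ∀ w, ⟪(Φ.trans M) w, m⟫_ℝ = ⟪Φ w, M.symm m⟫_ℝ := by
    intro w
    rw [LinearIsometryEquiv.trans_apply]
    conv_lhs => rw [← M.apply_symm_apply m]
    rw [M.inner_map_map]
  simp only [key, M.symm.norm_map]

/-- A reflection is its own inverse. -/
theorem Rf_symm_apply (n : Fin 3 → ℚ) (x : EuclideanSpace ℝ (Fin 3)) : (Rf n).symm x = Rf n x := by
  rw [Rf, Submodule.reflection_symm]

/-- REFLECTING a rational frame across its own menu normal `nv (w c)`: again a rational frame. -/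
def RatFrame.reflect (F : RatFrame) (c₀ : Fin 8) : RatFrame where
  Φ := F.Φ.trans (Rf (F.w c₀))
  g := gR (F.w c₀) F.g
  w := wR (F.w c₀) F.w
  hslot := fun i => by
    rw [LinearIsometryEquiv.trans_apply, F.hslot, Rf_apply_Qr_iptQ (F.hw c₀)]; rfl
  hmenu := fun m hm => by
    rw [isMenuNormal_trans_iff, Rf_symm_apply] at hm
    obtain ⟨c, hc⟩ := F.hmenu _ hm
    refine ⟨c, ?_⟩
    have : m = Rf (F.w c₀) (Rf (F.w c₀) m) := by rw [← Rf_symm_apply, (Rf (F.w c₀)).symm_apply_apply]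
    rw [this, hc, Rf_apply_nv (F.hw c₀)]; rfl
  hmenu' := fun c => by
    rw [isMenuNormal_trans_iff, Rf_symm_apply]
    show IsMenuNormal F.Φ ((Rf (F.w c₀)) (nv (rq (F.w c₀) (F.w c))))
    rw [← Rf_apply_nv (F.hw c₀), Rf, Submodule.reflection_reflection]
    exact F.hmenu' c
  hinner := fun i c => by
    show ⟪(F.Φ.trans (Rf (F.w c₀))) (slotSite i), nv (rq (F.w c₀) (F.w c))⟫_ℝ = _
    rw [LinearIsometryEquiv.trans_apply, ← Rf_apply_nv (F.hw c₀), (Rf (F.w c₀)).inner_map_map, F.hinner]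
  hw := fun c => by
    show dq (rq (F.w c₀) (F.w c)) (rq (F.w c₀) (F.w c)) = 3
    rw [dq_rq (F.hw c₀), F.hw]


end EndRowFloor

end Summit.Ventures.Crystal3D.Theorems

end
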